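import Literature.AnabelianGeometry.AbsoluteAnabelian.AbsTopII.SemiEllipticCor33iiTFProducer
import HarnessLib

/-!
# [AbsTopII] Cor 3.3 (ii) over a class `𝒟`: INSTANCE FORMS of the schema `EllipticModel.Cor_3_3_ii`
# (FACT-LIST F-0290) and of its print-faithful successor `EllipticModel.Cor_3_3_iiTF` at the
# `(𝒟, M)`-models PRESENTED by an isogeny-level model (kernel proofs)

S. Mochizuki, *Topics in Absolute Anabelian Geometry II: Decomposition Groups and Endomorphisms*
[AbsTopII] (bib `MochizukiAbsTopII2013`; kurims manuscript `paper:url-585b8d0ad0d9`), §3, Corollary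
3.3 (ii) p. 68: "the collection of open subgroups `Π_D ⊆ Π_C` that arise from finite étale double
coverings `D → C` that exhibit `C` as semi-elliptic [cf. Remark 3.1.1] may be characterized
'group-theoretically' as the collection of open subgroups `J ⊆ Π_C` of index `2` such that `J ∩ Δ_C`
[where `Δ_C := Ker(Π_C ↠ G')`] is torsion-free [i.e., the covering determined by `J` is a scheme — cf.
[AbsTopI], Lemma 4.1, (iv)]"; proof p. 69 l.1–4 ("follow immediately from the definitions, together
with the various references quoted").

PROOF-ONLY file (cell abc-iut, block F, seat abc-iut-f-174 gen 5, KEY row «F0290»; no `def`, no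
instance, no notation, no new named fact).  CONTEXT.  The `(𝒟, M)`-relative typing
`EllipticModel.Cor_3_3_ii` (abc-iut-L4-t6, `EllipticCuspidalizationComparison.lean`, FACT-LIST
**F-0290**) carries "`C` a `k`-core of `X`" (`coreExt`) and the left-hand side "the `Π_D ⊆ Π_C` of the
semi-elliptic double coverings" (`doubleCovers`) as FREE model data; its universal closure over
`(𝒟, M)` is refuted (`EllipticModel.not_forall_cor_3_3_ii`, abc-iut-f-067) and the row is consumed BY
NAME at instances.  Its right-hand side renders "torsion-free" by Mathlib's unique-roots class
`IsMulTorsionFree` (finding T1g11-F1), so the row is FALSE at every model exhibiting one genuine `Π_D`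
(`EllipticModel.cor_3_3_ii_false_of`, abc-iut-L4-t4); the print-faithful successor is
`EllipticModel.Cor_3_3_iiTF` (`EllipticCuspidalizationComparisonTF.lean`), whose node closers are
landed (`SemiEllipticTransportTF.lean`) but which had NO producer.  The ISOGENY-LEVEL twin `Cor_3_3_ii M₀`
(FACT-LIST F-0234, `M₀ : IsogenyModel`) computes its left-hand side from the model's finite étale
morphisms (`IsogenyModel.ellipticDoubleCoverImages`), and for ITS successor `Cor_3_3_iiTF M₀` the tree
holds abc-iut-L4-t4's producer from the three printed inputs `cor_3_3_iiTF_of_lem41iv_rmk311` and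
abc-iut-L4-t10's geometric model `exists_cor_3_3_iiTF_geometricModel`.

THE NATURAL INSTANCE.  An `EllipticModel M` over `𝒟` is *presented* by an isogeny-level model `M₀` at
a member `X` when its `k`-core `Π_C ↠ G` is, as a profinite group with its `Δ_C`, a semi-elliptic
curve `C₀` of `M₀` (`φ : Π_{C₀} ⥲ Π_C`, `φ(Δ_{C₀}) = Δ_C`) and its `doubleCovers` are the
`φ`-transports of the `Π_D`'s of the semi-elliptic double coverings of `C₀` in `M₀` — i.e. the free
field `doubleCovers` is READ OFF an isogeny-level model instead of being chosen by fiat.  Displayed as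
a hypothesis (`hpres`), once per theorem.  PROVED here:
* `cor_3_3_ii_of_isogenyModel` — **F-0290 at presented models follows from F-0234 at the presenting
  model** (direct-head instance form of `EllipticModel.Cor_3_3_ii`);
* `cor_3_3_iiTF_of_isogenyModel` — the same for the print-faithful successors;
* ★ `cor_3_3_iiTF_of_isogenyModel_of_lem41iv_rmk311` — **PRODUCER of `EllipticModel.Cor_3_3_iiTF`** at
  every presented model from print's three inputs on `M₀` ("the covering determined by `J`",
  [AbsTopI] Lem 4.1 (iv), Rmk 3.1.1 — abc-iut-L4-t4's displayed hypotheses `hcov`, `h41`, `h311`);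
* `not_cor_3_3_ii_of_presented_member` / `not_cor_3_3_ii_and_cor_3_3_iiTF_of_isogenyModel_of_lem41iv_rmk311`
  — SEPARATION carried to `(𝒟, M)`: one Cor-3.3 member presented at a curve `C₀` exhibiting a genuine
  `Π_D` whose `Π_D ∩ Δ_{C₀}` lacks unique roots (e.g. `≅ F̂₂`) falsifies F-0290 while the successor is
  produced.
All by the landed transport lemmas `image_semiEllipticDoubleCoverSubgroups_eq` (abc-iut-L4-t6) /
`image_semiEllipticDoubleCoverSubgroupsTF_eq` (abc-iut-L4-t4).

HONEST FRAMING: CONDITIONAL instance forms for OUR typing; the presentation hypothesis is a displayed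
hypothesis, not instantiated here at a class with a Cor-3.3 member (no étale-`π₁` producer in the tree);
print's three inputs stay hypotheses; conditional ≠ proved; typed ≠ proved; refuted-as-typed ≠
refuted-in-print; nothing here bears on [IUTchIII] Cor 3.12 or asserts that abc is proved or refuted.
Axioms standard.
-/

namespace Literature.AnabelianGeometry.AbsoluteAnabelian.AbsTopII

open FundamentalExtension
open AbsTopI (ConstructionDataClass)

universe u

namespace EllipticModel

variable {𝒟 : ConstructionDataClass.{u}} {M : EllipticModel 𝒟}

/-! ### F-0290 and its successor at presented models -/

/-- **F-0290, INSTANCE FORM at presented models: `EllipticModel.Cor_3_3_ii M` follows from the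
isogeny-level `Cor_3_3_ii M₀` (F-0234) whenever every Cor-3.3 member of `M` is presented by `M₀`** —
its `k`-core `Π_C` is `Π_{C₀}` of a semi-elliptic curve `C₀` of `M₀` through `φ` with
`φ(Δ_{C₀}) = Δ_C`, and its `doubleCovers` are the `φ`-transports of the `Π_D`'s of the semi-elliptic
double coverings of `C₀` (the group-theoretic right-hand side is `φ`-invariant,
`image_semiEllipticDoubleCoverSubgroups_eq`). [cite: MochizukiAbsTopII2013, Cor 3.3 (ii) p.68] -/
theorem cor_3_3_ii_of_isogenyModel (M₀ : IsogenyModel.{u})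
    (hpres : ∀ (b : 𝒟.Base) (X : (𝒟.datum b).Obj), M.IsCor33Member b X →
      ∃ (C₀ : M₀.Curve) (_ : M₀.IsSemiElliptic C₀) (φ : (M₀.ext C₀).arith ≃ₜ* (M.coreExt b X).arith),
        (M₀.ext C₀).geom.map φ.toMulEquiv.toMonoidHom = (M.coreExt b X).geom ∧
          M.doubleCovers b X =
            (fun J : Subgroup (M₀.ext C₀).arith => J.map φ.toMulEquiv.toMonoidHom) ''
              M₀.ellipticDoubleCoverImages C₀)
    (h₀ : Literature.AnabelianGeometry.AbsoluteAnabelian.AbsTopII.Cor_3_3_ii M₀) :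
    M.Cor_3_3_ii := by
  intro _ _ b X hX
  obtain ⟨C₀, hC₀, φ, hφ, hdc⟩ := hpres b X hX
  rw [hdc, (cor_3_3_ii_iff M₀).mp h₀ C₀ hC₀]
  exact image_semiEllipticDoubleCoverSubgroups_eq φ hφ

/-- **The print-faithful successor at presented models**: `EllipticModel.Cor_3_3_iiTF M` follows from
the isogeny-level successor `Cor_3_3_iiTF M₀` whenever every Cor-3.3 member of `M` is presented by `M₀`
(`image_semiEllipticDoubleCoverSubgroupsTF_eq`). [cite: MochizukiAbsTopII2013, Cor 3.3 (ii) p.68] -/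
theorem cor_3_3_iiTF_of_isogenyModel (M₀ : IsogenyModel.{u})
    (hpres : ∀ (b : 𝒟.Base) (X : (𝒟.datum b).Obj), M.IsCor33Member b X →
      ∃ (C₀ : M₀.Curve) (_ : M₀.IsSemiElliptic C₀) (φ : (M₀.ext C₀).arith ≃ₜ* (M.coreExt b X).arith),
        (M₀.ext C₀).geom.map φ.toMulEquiv.toMonoidHom = (M.coreExt b X).geom ∧
          M.doubleCovers b X =
            (fun J : Subgroup (M₀.ext C₀).arith => J.map φ.toMulEquiv.toMonoidHom) ''
              M₀.ellipticDoubleCoverImages C₀)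
    (h₀ : Literature.AnabelianGeometry.AbsoluteAnabelian.AbsTopII.Cor_3_3_iiTF M₀) :
    M.Cor_3_3_iiTF := by
  intro _ _ b X hX
  obtain ⟨C₀, hC₀, φ, hφ, hdc⟩ := hpres b X hX
  rw [hdc, h₀ C₀ hC₀]
  exact image_semiEllipticDoubleCoverSubgroupsTF_eq φ hφ

/-- ★ **PRODUCER of the print-faithful `EllipticModel.Cor_3_3_iiTF` at every presented model, from the
three printed inputs Cor 3.3 (ii) quotes** — on the presenting isogeny-level model `M₀`: `hcov` "the
covering determined by `J`" (every open `J ⊆ Π_C` of index `2` is a `Π_D`), `h41` [AbsTopI] Lemma 4.1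
(iv) ("`X` is a hyperbolic curve iff `Δ` is torsion-free"), `h311` Remark 3.1.1 (a double covering of a
semi-elliptic `C` over `k` by a hyperbolic curve is once-punctured elliptic); abc-iut-L4-t4's
`cor_3_3_iiTF_of_lem41iv_rmk311` composed with `cor_3_3_iiTF_of_isogenyModel`.  CONDITIONAL on the
displayed inputs. [cite: MochizukiAbsTopII2013, Cor 3.3 (ii) p.68] -/
theorem cor_3_3_iiTF_of_isogenyModel_of_lem41iv_rmk311 (M₀ : IsogenyModel.{u})
    (hpres : ∀ (b : 𝒟.Base) (X : (𝒟.datum b).Obj), M.IsCor33Member b X →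
      ∃ (C₀ : M₀.Curve) (_ : M₀.IsSemiElliptic C₀) (φ : (M₀.ext C₀).arith ≃ₜ* (M.coreExt b X).arith),
        (M₀.ext C₀).geom.map φ.toMulEquiv.toMonoidHom = (M.coreExt b X).geom ∧
          M.doubleCovers b X =
            (fun J : Subgroup (M₀.ext C₀).arith => J.map φ.toMulEquiv.toMonoidHom) ''
              M₀.ellipticDoubleCoverImages C₀)
    (hcov : ∀ (C : M₀.Curve) (J : Subgroup (M₀.ext C).arith), IsOpen (J : Set (M₀.ext C).arith) →
      J.index = 2 → ∃ (D : M₀.Curve) (f : M₀.FinEt D C), M₀.arithImage f = J)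
    (h41 : ∀ X : M₀.Curve, M₀.IsScheme X ↔ ∀ g : ↥(M₀.ext X).geom, IsOfFinOrder g → g = 1)
    (h311 : ∀ C : M₀.Curve, M₀.IsSemiElliptic C → ∀ (D : M₀.Curve) (f : M₀.FinEt D C), M₀.IsOver f →
      M₀.degree f = 2 → M₀.IsScheme D → M₀.IsOncePuncturedElliptic D) :
    M.Cor_3_3_iiTF :=
  cor_3_3_iiTF_of_isogenyModel M₀ hpres (M₀.cor_3_3_iiTF_of_lem41iv_rmk311 hcov h41 h311)

/-! ### Separation carried to `(𝒟, M)` -/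

/-- **F-0290 is FALSE at a model with ONE Cor-3.3 member presented at a curve `C₀` exhibiting a genuine
semi-elliptic double covering whose `Π_D ∩ Δ_{C₀}` lacks unique roots** (e.g. `≅ F̂₂`, the `Δ_D` of a
once-punctured elliptic curve: abc-iut-L4-t12's `Summit.ABC.IUTFork.not_isMulTorsionFree_of_isFreeProOn`,
abc-iut-L4-t10's `exists_cor_3_3_iiTF_geometricModel`): `J ↦ φ(J)` is injective, so
`EllipticModel.Cor_3_3_ii` would force `Π_D ∩ Δ_{C₀}` to have unique roots.
[cite: MochizukiAbsTopII2013, Cor 3.3 (ii) p.68] -/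
theorem not_cor_3_3_ii_of_presented_member (hfull : 𝒟.IsChainFull) (hrel : 𝒟.RelIsomDGC)
    {b : 𝒟.Base} {X : (𝒟.datum b).Obj} (hX : M.IsCor33Member b X) (M₀ : IsogenyModel.{u})
    {C₀ : M₀.Curve} (φ : (M₀.ext C₀).arith ≃ₜ* (M.coreExt b X).arith)
    (hφ : (M₀.ext C₀).geom.map φ.toMulEquiv.toMonoidHom = (M.coreExt b X).geom)
    (hdc : M.doubleCovers b X =
      (fun J : Subgroup (M₀.ext C₀).arith => J.map φ.toMulEquiv.toMonoidHom) ''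
        M₀.ellipticDoubleCoverImages C₀)
    {J₀ : Subgroup (M₀.ext C₀).arith} (hJ₀ : J₀ ∈ M₀.ellipticDoubleCoverImages C₀)
    (hnot : ¬ IsMulTorsionFree ↥(J₀ ⊓ (M₀.ext C₀).geom)) : ¬ M.Cor_3_3_ii := by
  intro h
  -- both collections at `C₀` have the same `φ`-transport, and `J ↦ φ(J)` is injective
  have himg : (fun J : Subgroup (M₀.ext C₀).arith => J.map φ.toMulEquiv.toMonoidHom) ''
        M₀.ellipticDoubleCoverImages C₀ =
      (fun J : Subgroup (M₀.ext C₀).arith => J.map φ.toMulEquiv.toMonoidHom) ''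
        semiEllipticDoubleCoverSubgroups (M₀.ext C₀) := by
    rw [← hdc, h hfull hrel b X hX, image_semiEllipticDoubleCoverSubgroups_eq φ hφ]
  have hinj : Function.Injective
      (fun J : Subgroup (M₀.ext C₀).arith => J.map φ.toMulEquiv.toMonoidHom) :=
    Subgroup.map_injective (show Function.Injective φ.toMulEquiv.toMonoidHom from φ.injective)
  have heq : M₀.ellipticDoubleCoverImages C₀ = semiEllipticDoubleCoverSubgroups (M₀.ext C₀) :=
    (Set.image_injective.mpr hinj) himg
  rw [heq] at hJ₀
  exact hnot hJ₀.2.2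

/-- **SEPARATION inside Cor 3.3 (ii), `(𝒟, M)`-relative**: at a model presented by an isogeny-level
`M₀` satisfying print's three inputs, with ONE Cor-3.3 member presented at a curve exhibiting a genuine
double covering whose `Π_D ∩ Δ_{C₀}` lacks unique roots, the predecessor `EllipticModel.Cor_3_3_ii`
(F-0290, Mathlib `IsMulTorsionFree` rendering) FAILS while the successor `EllipticModel.Cor_3_3_iiTF`
HOLDS. [cite: MochizukiAbsTopII2013, Cor 3.3 (ii) p.68] -/
theorem not_cor_3_3_ii_and_cor_3_3_iiTF_of_isogenyModel_of_lem41iv_rmk311 (M₀ : IsogenyModel.{u})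
    (hpres : ∀ (b : 𝒟.Base) (X : (𝒟.datum b).Obj), M.IsCor33Member b X →
      ∃ (C₀ : M₀.Curve) (_ : M₀.IsSemiElliptic C₀) (φ : (M₀.ext C₀).arith ≃ₜ* (M.coreExt b X).arith),
        (M₀.ext C₀).geom.map φ.toMulEquiv.toMonoidHom = (M.coreExt b X).geom ∧
          M.doubleCovers b X =
            (fun J : Subgroup (M₀.ext C₀).arith => J.map φ.toMulEquiv.toMonoidHom) ''
              M₀.ellipticDoubleCoverImages C₀)
    (hcov : ∀ (C : M₀.Curve) (J : Subgroup (M₀.ext C).arith), IsOpen (J : Set (M₀.ext C).arith) →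
      J.index = 2 → ∃ (D : M₀.Curve) (f : M₀.FinEt D C), M₀.arithImage f = J)
    (h41 : ∀ X : M₀.Curve, M₀.IsScheme X ↔ ∀ g : ↥(M₀.ext X).geom, IsOfFinOrder g → g = 1)
    (h311 : ∀ C : M₀.Curve, M₀.IsSemiElliptic C → ∀ (D : M₀.Curve) (f : M₀.FinEt D C), M₀.IsOver f →
      M₀.degree f = 2 → M₀.IsScheme D → M₀.IsOncePuncturedElliptic D)
    (hfull : 𝒟.IsChainFull) (hrel : 𝒟.RelIsomDGC) {b : 𝒟.Base} {X : (𝒟.datum b).Obj}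
    (hX : M.IsCor33Member b X) {C₀ : M₀.Curve} (φ : (M₀.ext C₀).arith ≃ₜ* (M.coreExt b X).arith)
    (hφ : (M₀.ext C₀).geom.map φ.toMulEquiv.toMonoidHom = (M.coreExt b X).geom)
    (hdc : M.doubleCovers b X =
      (fun J : Subgroup (M₀.ext C₀).arith => J.map φ.toMulEquiv.toMonoidHom) ''
        M₀.ellipticDoubleCoverImages C₀)
    {J₀ : Subgroup (M₀.ext C₀).arith} (hJ₀ : J₀ ∈ M₀.ellipticDoubleCoverImages C₀)
    (hnot : ¬ IsMulTorsionFree ↥(J₀ ⊓ (M₀.ext C₀).geom)) :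
    ¬ M.Cor_3_3_ii ∧ M.Cor_3_3_iiTF :=
  ⟨not_cor_3_3_ii_of_presented_member hfull hrel hX M₀ φ hφ hdc hJ₀ hnot,
    cor_3_3_iiTF_of_isogenyModel_of_lem41iv_rmk311 M₀ hpres hcov h41 h311⟩

end EllipticModel

end Literature.AnabelianGeometry.AbsoluteAnabelian.AbsTopII
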